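import Summits.QuantumFields.BalabanUV.T4Continuum.Support.NE3DressedBlockField
import HarnessLib

/-!
# T⁴ programme, node NE3 — row E-MLw-(w4)-P-curved, row K5b (covariant half of K5), file 2: COARSE DATA IN THE CORNER'S FRAME — the
# axial gauge of a coarse datum based at a block corner, and its flat differences against the covariant differences `D_U m`

NE3 (node U1b) formalisation swarm, leaf seat `b2b-balaban-t4-ne3-formalise-leaf-01` (gen 5); row **K5** of ruling ρ-g22-2 (holder
leaf-01-g5), design `HOME/b2b-balaban-t4-ne3-formalise-leaf-01/g5/K5b-DESIGN.md` §1∕(E2); sequel of `NE3DressedBlockField` (p228623).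

THE OBJECT.  For a coarse unitary bond field `U` (the consumer's background on the unit lattice of block corners) and a coarse datum `m`,
the FRAME-`z` DATUM `frameData U m z w := Ad (btree 1 U z w) (m w)` — `m w` transported to `z` along the tree word `Γ_{z,w}` of
[Balaban1985Averaging] p. 24 (the axial gauge of `m` based at `z`).  It is the input of K5a's flat `bmeInterp` on block `z` in the design's
`I_W`.  CONTENT ([folklore] + the axial-gauge bound of B7 p. 24–25; 0 sorry; one DATA def):
* `frameData_self` (`= m z` at `w = z`), `frameData_mem_skewAdjoint`, `norm_frameData` (`‖·‖ = ‖m w‖`);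
* **`dPot_frameData_eq`** — `dPot (frameData U m z) w α = (Ad (A_{w,α})⁻¹ (frameData U m z w) − frameData U m z w) − Ad (btree 1 U z (w + e_α)) (gaugeDir U m w α)`
  with the AXIAL-GAUGE BOND `A_{w,α} = gaugeAct (btree 1 U z) U w α` (a tree-based loop; `= 1` on tree bonds);
* **`norm_dPot_frameData_le`** — for `z ≤ w`, `SmallField U a_U`: `‖dPot (frameData U m z) w α‖ ≤ ‖gaugeDir U m w α‖ + 2·(l1 (lowPart α (w − z))·a_U)·‖m w‖`
  (C0 `NE3CombGauge.norm_Ad_comb_inv_sub_le` at scale `M = 1`), and on the unit cube above `z` (`w − z ≤ 1`):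
  **`norm_dPot_frameData_cube_le`** — `≤ ‖gaugeDir U m w α‖ + 2·(d−1)·a_U·‖m w‖`: flat differences of the frame data = COVARIANT differences
  + an `a_U`-sized transport defect on the VALUE (the design's `a_U²·Σ‖m‖²` term).

HONEST FRAMING.  Kinematics at ONE coarse background; nothing about Bałaban's minimisers; (P♮)∕(ML_w) at W ≠ 1, T-E_w and **NE3 are NOT
proved**; spine PROVED 0∕9; finite T⁴ rung (B)+1 — NOT infinite volume, NOT mass gap, NOT `BetaPertH`, NOT Clay.  PLACEMENT:
`Summits/QuantumFields/BalabanUV/`.  HONEST DEPENDENCY (cell page 1): continuum YM on T⁴ ⇐ BetaPertH ∧ nine spine estimates (0/9 proved);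
BetaPertH ⇐ (D1) ∧ (D4) ∧ CAP+tail; G-an2-4 gates asym, D1 and NE2/3/4.
-/

set_option autoImplicit false

open scoped BigOperators Matrix.Norms.L2Operator
open Finset

namespace Summit.QuantumFields.BalabanUV.T4Continuum.NE3CoarseFrameData

open Literature.MathematicalPhysics.QuantumFieldTheory.Balaban1983to89
open B7Prop1Explicit B7Prop2Explicit
open B8Lemma1NonAbelian (lowPart)
open T4AveragingDeficitWall (IsUnitaryCfg IsSkewDir SmallField Ad)
open T4AveragingDeficitNonAbelian (Ad_mul Ad_sub)
open AveragingDeficitTransport (Ad_mem_skewAdjoint norm_Ad_of_unitary)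
open AveragingDeficitNearIdentity (Ad_one)
open AveragingDeficitBlockDensity (btree btree_mem)
open BlockAveragePushDirGauge (gaugeDir)
open NE3TangentNoGoWords (dPot)
open NE3CombGauge (btree_corner norm_Ad_comb_inv_sub_le l1_lowPart_le_single isUnitaryCfg_comb)
open NE3CombGaugeCharge (gaugeDir_gaugeAct_eq)
open NE3GaugeDirFrames (Ad_Ad_inv)

noncomputable section

variable {d : ℕ} {n : Type*} [Fintype n] [DecidableEq n]

/-- **THE FRAME-`z` DATUM**: `m w` read in the frame of the corner `z` through the tree transport `btree 1 U z w = U(Γ_{z,w})`. [folklore] -/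
def frameData (U : Site d → Fin d → (Matrix n n ℂ)ˣ) (m : Site d → Matrix n n ℂ) (z : Site d) : Site d → Matrix n n ℂ :=
  fun w => Ad (btree 1 U z w) (m w)

/-- `(1:ℕ)`-scaled corners are the sites themselves. [folklore] -/
theorem one_smul_site (z : Site d) : ((1 : ℕ) : ℤ) • z = z := by simp

/-- At its own corner the frame datum is the datum. [folklore] -/
theorem frameData_self (U : Site d → Fin d → (Matrix n n ℂ)ˣ) (m : Site d → Matrix n n ℂ) (z : Site d) : frameData U m z z = m z := by
  unfold frameData
  have h := btree_corner 1 U z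
  rw [one_smul_site] at h
  rw [h, Ad_one]

/-- The frame datum of 𝔲(n)-valued data at a unitary background is 𝔲(n)-valued. [folklore] -/
theorem frameData_mem_skewAdjoint {U : Site d → Fin d → (Matrix n n ℂ)ˣ} (hU : IsUnitaryCfg U) {m : Site d → Matrix n n ℂ}
    (hm : ∀ w, m w ∈ skewAdjoint (Matrix n n ℂ)) (z w : Site d) : frameData U m z w ∈ skewAdjoint (Matrix n n ℂ) :=
  Ad_mem_skewAdjoint (btree_mem hU 1 z w) (hm w)

/-- The transport is an isometry: `‖frameData U m z w‖ = ‖m w‖`. [folklore] -/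
theorem norm_frameData {U : Site d → Fin d → (Matrix n n ℂ)ˣ} (hU : IsUnitaryCfg U) (m : Site d → Matrix n n ℂ) (z w : Site d) :
    ‖frameData U m z w‖ = ‖m w‖ :=
  norm_Ad_of_unitary (btree_mem hU 1 z w) (m w)

/-- Undoing the transport recovers the datum. [folklore] -/
theorem Ad_inv_frameData (U : Site d → Fin d → (Matrix n n ℂ)ˣ) (m : Site d → Matrix n n ℂ) (z w : Site d) :
    Ad (btree 1 U z w)⁻¹ (frameData U m z w) = m w := by
  unfold frameData
  rw [← Ad_mul, inv_mul_cancel, Ad_one]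

/-- **FLAT DIFFERENCES OF THE FRAME DATUM = COVARIANT DIFFERENCES + THE AXIAL-GAUGE LOOP ON THE VALUE**:
`dPot (frameData U m z) w α = (Ad (A_{w,α})⁻¹ X − X) − Ad (btree 1 U z (w + e_α)) (gaugeDir U m w α)`, `X = frameData U m z w`,
`A_{w,α} = gaugeAct (btree 1 U z) U w α` (gauge covariance of `gaugeDir`: C0 `gaugeDir_gaugeAct_eq`). [cite: Balaban1985Averaging, (8) p.18, p.24] -/
theorem dPot_frameData_eq (U : Site d → Fin d → (Matrix n n ℂ)ˣ) (m : Site d → Matrix n n ℂ) (z w : Site d) (α : Fin d) :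
    dPot (frameData U m z) w α
      = (Ad (gaugeAct (btree 1 U z) U w α)⁻¹ (frameData U m z w) - frameData U m z w)
          - Ad (btree 1 U z (w + e α)) (gaugeDir U m w α) := by
  -- gauge covariance: `gaugeDir (U^u) (m^u) = Ad (u (w+e_α)) (gaugeDir U m)` with `u = btree 1 U z`, `m^u = frameData`
  have hcov : gaugeDir (gaugeAct (btree 1 U z) U) (frameData U m z) w α = Ad (btree 1 U z (w + e α)) (gaugeDir U m w α) := by
    rw [gaugeDir_gaugeAct_eq]
    congr 1
    have hfun : (fun y => Ad (btree 1 U z y)⁻¹ (frameData U m z y)) = m := funext fun y => Ad_inv_frameData U m z y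
    rw [hfun]
  have hdef : gaugeDir (gaugeAct (btree 1 U z) U) (frameData U m z) w α
      = Ad (gaugeAct (btree 1 U z) U w α)⁻¹ (frameData U m z w) - frameData U m z (w + e α) := rfl
  simp only [dPot]
  rw [← hcov, hdef]
  abel

/-- **THE BOUND**: `U` unitary with `SmallField U a_U`; for `z ≤ w`,
`‖dPot (frameData U m z) w α‖ ≤ ‖gaugeDir U m w α‖ + 2·(l1 (lowPart α (w − z))·a_U)·‖m w‖`. [cite: Balaban1985Averaging, pp.24–25] -/
theorem norm_dPot_frameData_le [Nonempty n] {U : Site d → Fin d → (Matrix n n ℂ)ˣ} (hU : IsUnitaryCfg U) {aU : ℝ}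
    (hUa : SmallField U aU) (m : Site d → Matrix n n ℂ) {z w : Site d} (hw : z ≤ w) (α : Fin d) :
    ‖dPot (frameData U m z) w α‖ ≤ ‖gaugeDir U m w α‖ + 2 * ((l1 (lowPart α (w - z)) : ℝ) * aU) * ‖m w‖ := by
  rw [dPot_frameData_eq]
  refine (norm_sub_le _ _).trans ?_
  rw [add_comm, norm_Ad_of_unitary (btree_mem hU 1 z _)]
  refine add_le_add le_rfl ?_
  have hw' : ((1 : ℕ) : ℤ) • z ≤ w := by rw [one_smul_site]; exact hw
  have h := norm_Ad_comb_inv_sub_le hU hUa z hw' α (frameData U m z w)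
  rw [one_smul_site, norm_frameData hU] at h
  exact h

/-- **ON THE UNIT CUBE ABOVE `z`** (`z ≤ w ≤ z + 𝟙`): `‖dPot (frameData U m z) w α‖ ≤ ‖gaugeDir U m w α‖ + 2·((d−1)·a_U)·‖m w‖`
(`0 ≤ a_U`). [cite: Balaban1985Averaging, pp.24–25] -/
theorem norm_dPot_frameData_cube_le [Nonempty n] {U : Site d → Fin d → (Matrix n n ℂ)ˣ} (hU : IsUnitaryCfg U) {aU : ℝ}
    (haU : 0 ≤ aU) (hUa : SmallField U aU) (m : Site d → Matrix n n ℂ) {z w : Site d} (hw : z ≤ w) (hw' : w ≤ z + fun _ => (1 : ℤ))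
    (α : Fin d) :
    ‖dPot (frameData U m z) w α‖ ≤ ‖gaugeDir U m w α‖ + 2 * (((d : ℝ) - 1) * aU) * ‖m w‖ := by
  refine (norm_dPot_frameData_le hU hUa m hw α).trans (add_le_add le_rfl ?_)
  have hv0 : 0 ≤ w - z := sub_nonneg.mpr hw
  have hv1 : w - z ≤ fun _ => ((2 : ℕ) : ℤ) - 1 := by
    intro i
    have := hw' i
    simp only [Pi.sub_apply, Pi.add_apply] at this ⊢
    push_cast
    linarith
  have hl1 := l1_lowPart_le_single (M := 2) α hv0 hv1
  have h1 : (l1 (lowPart α (w - z)) : ℝ) * aU ≤ ((d : ℝ) - 1) * aU := by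
    have : (l1 (lowPart α (w - z)) : ℝ) ≤ (d : ℝ) - 1 := by
      have h2 := hl1
      push_cast at h2
      linarith
    exact mul_le_mul_of_nonneg_right this haU
  exact mul_le_mul_of_nonneg_right (mul_le_mul_of_nonneg_left h1 (by norm_num)) (norm_nonneg _)

end

end Summit.QuantumFields.BalabanUV.T4Continuum.NE3CoarseFrameData
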